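import Mathlib
import Summits.KontsevichZagierPeriods.KontsevichZagierPeriods.Theorems.SoloInformedTelescopeKit
import HarnessLib
import HarnessLib.Audit

/-!
# SoloInformed — the Möbius telescope STEP in any dimension (PART XVI, THEOREM XXXIII): data and maps

Solo programme `solo-KontsevichZagierPeriods-informed`, session s45. The step `𝕁(Q, ω; c)` of the
Möbius telescope, in dimension `n` with one ACTIVE coordinate `i` and all other coordinates
passive:

  `R₁ = [D ∩ {ω < xᵢ}, c/((1 − Q xᵢ)(1 − ω))]`,  `R₂ = [D, c/((1 − Q xᵢ)(1 − Q xᵢ ω))]`,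

where `Q, ω` are polynomials and `c = 1/C` with `C` a polynomial, none involving `xᵢ`, with
`0 ≤ Q < 1`, `0 < ω < 1`, `C > 0` on the cylinder `D` (a `ℚ`-semialgebraic set invariant under
changing `xᵢ` inside `(0,1)`). THEOREM (`SoloInformedTelescopeStepMoves`): `[R₁] − [R₂] ∈ relations`
by five moves of types (1a), (1b), (2), the last along the Möbius substitution
`σ(v) = ω(ω + v(1 − ω − Qω²))/(1 − Qω²v)`.

This file: the datum (`SoloInformedTelDatum`), the integrands and their pointwise identities, the
domains `D₁ = D ∩ {ω < xᵢ}`, `D₂ = D ∩ {xᵢ < ω}`, `D♯ = D ∩ {ω² < xᵢ < ω}`. The maps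
`Φ(x) = (xᵢ ↦ xᵢω)` and `Ψ(x) = (xᵢ ↦ σ(xᵢ))` are in `SoloInformedTelescopeStepMaps`, the moves in
`SoloInformedTelescopeStepMoves`.

References: Kontsevich–Zagier, *Periods* (2001) §1.2 [KontsevichZagier2001]; S. Yamamoto,
arXiv:1405.6499, Thm 1.2; M. Kaneko, S. Yamamoto, arXiv:1605.03117, Thm 4.6.
-/

noncomputable section

open MeasureTheory Set MvPolynomial
open Literature.ModelTheory.ExponentialFields Literature.NumberTheory.Transcendental
open Literature.NumberTheory.Transcendental.KZ

namespace Summit.KontsevichZagierPeriods.KontsevichZagierPeriods.Theorems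

/-! ## 0. Generic helpers -/

/-- The determinant of the identity matrix with one row replaced is the diagonal entry of that
row. [folklore] -/
theorem soloInformed_det_updateRow_one {ι : Type*} [Fintype ι] [DecidableEq ι] {R : Type*}
    [CommRing R] (j : ι) (c : ι → R) :
    ((1 : Matrix ι ι R).updateRow j c).det = c j := by
  have hc : (∑ k, c k • (1 : Matrix ι ι R) k) = c := by
    ext l
    simp [Finset.sum_apply, Matrix.one_apply]
  rw [← hc, Matrix.det_updateRow_sum, Matrix.det_one, smul_eq_mul, mul_one, hc]

/-- A polynomial not involving `Xᵢ` does not see a change of the `i`-th coordinate. -/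
theorem soloInformed_aeval_update {n : ℕ} {p : MvPolynomial (Fin n) ℚ} {i : Fin n}
    (h : i ∉ p.vars) (x : Fin n → ℝ) (t : ℝ) :
    aeval (Function.update x i t) p = aeval x p := by
  rw [MvPolynomial.aeval_def, MvPolynomial.aeval_def]
  exact eval₂Hom_congr' rfl (fun l hl _ => by
    rw [Function.update_of_ne (ne_of_mem_of_not_mem hl h)]) rfl

/-- Two points agreeing off the `i`-th coordinate give the same value to a polynomial without
`Xᵢ`. -/
theorem soloInformed_aeval_eq_of_eq_off {n : ℕ} {p : MvPolynomial (Fin n) ℚ} {i : Fin n}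
    (h : i ∉ p.vars) {x x' : Fin n → ℝ} (hxx' : ∀ j, j ≠ i → x j = x' j) :
    (aeval x p : ℝ) = aeval x' p := by
  have hx' : x' = Function.update x i (x' i) := by
    ext j
    by_cases hj : j = i
    · subst hj; simp
    · rw [Function.update_of_ne hj, hxx' j hj]
  rw [hx', soloInformed_aeval_update h]

/-- The zero set in `ℝⁿ` of a non-zero polynomial with rational coefficients is null. [folklore] -/
theorem soloInformed_volume_zeroSet {n : ℕ} (q : MvPolynomial (Fin n) ℚ) (hq : q ≠ 0) :
    volume {x : Fin n → ℝ | MvPolynomial.aeval x q = 0} = 0 :=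
  volume_setOf_aeval_eq_zero q fun h => hq
    (MvPolynomial.map_injective (algebraMap ℚ ℝ) (algebraMap ℚ ℝ).injective
      (by rw [h, map_zero]))

/-- A subset of the zero set of a non-zero rational polynomial is null. -/
theorem soloInformed_volume_eq_zero_of_subset_zeroSet {n : ℕ} {Z : Set (Fin n → ℝ)}
    (q : MvPolynomial (Fin n) ℚ) (hq : q ≠ 0)
    (hZ : ∀ x ∈ Z, (MvPolynomial.aeval x q : ℝ) = 0) : volume Z = 0 :=
  measure_mono_null (fun x hx => hZ x hx) (soloInformed_volume_zeroSet q hq)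

/-- Semialgebraicity of a quotient integrand `p/q` written as a real function. -/
theorem soloInformed_isSemialgebraicFunOn_quot {n : ℕ} {D : Set (Fin n → ℝ)}
    (hD : IsSemialgebraic ℚ D) (p q : MvPolynomial (Fin n) ℚ) (f : (Fin n → ℝ) → ℝ)
    (hq : ∀ x ∈ D, (aeval x q : ℝ) ≠ 0) (hf : ∀ x ∈ D, (aeval x p : ℝ) / aeval x q = f x) :
    IsSemialgebraicFunOn ℚ D f :=
  (isSemialgebraicFunOn_aeval_div_aeval hD p q hq).congr hf

/-! ## 1. The integrands -/

/-- `f₁ = 1/(C (1 − Q xᵢ)(1 − ω))`, the `R₁`-integrand. -/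
def soloInformedStepF1 {n : ℕ} (i : Fin n) (Q Ω C : MvPolynomial (Fin n) ℚ) (x : Fin n → ℝ) : ℝ :=
  1 / ((aeval x C : ℝ) * (1 - aeval x Q * x i) * (1 - aeval x Ω))

/-- `S = 1/(C (1 − Q xᵢ)(1 − Q xᵢ ω))`, the `R₂`-integrand. -/
def soloInformedStepFS {n : ℕ} (i : Fin n) (Q Ω C : MvPolynomial (Fin n) ℚ) (x : Fin n → ℝ) : ℝ :=
  1 / ((aeval x C : ℝ) * (1 - aeval x Q * x i) * (1 - aeval x Q * x i * aeval x Ω))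

/-- **The datum of a telescope step**: active coordinate `i`, polynomials `Q, ω, C` free of `Xᵢ`,
a `ℚ`-semialgebraic measurable cylinder `D` over `xᵢ ∈ (0,1)` on which `0 ≤ Q < 1`, `0 < ω < 1`,
`C > 0`, and integrability of the two sides. -/
structure SoloInformedTelDatum (n : ℕ) where
  /-- the active coordinate -/
  i : Fin n
  /-- the passive polynomial `Q` (`0 ≤ Q < 1` on `D`) -/
  Q : MvPolynomial (Fin n) ℚ
  /-- the passive polynomial `ω` (`0 < ω < 1` on `D`) -/
  Ω : MvPolynomial (Fin n) ℚ
  /-- the passive polynomial `C` (`C > 0` on `D`); the integrands carry the factor `1/C` -/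
  C : MvPolynomial (Fin n) ℚ
  /-- the cylinder -/
  D : Set (Fin n → ℝ)
  /-- `D` is `ℚ`-semialgebraic -/
  isSemialgebraic_D : IsSemialgebraic ℚ D
  /-- `D` is measurable -/
  measurableSet_D : MeasurableSet D
  /-- `D` is invariant under moving the active coordinate inside `(0,1)` -/
  update_mem : ∀ x ∈ D, ∀ t : ℝ, 0 < t → t < 1 → Function.update x i t ∈ D
  /-- on `D` the active coordinate lies in `(0,1)` -/
  mem_Ioo : ∀ x ∈ D, 0 < x i ∧ x i < 1
  /-- `Q` does not involve `Xᵢ` -/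
  vars_Q : i ∉ Q.vars
  /-- `ω` does not involve `Xᵢ` -/
  vars_Ω : i ∉ Ω.vars
  /-- `C` does not involve `Xᵢ` -/
  vars_C : i ∉ C.vars
  /-- `0 ≤ Q < 1` on `D` -/
  Q_bound : ∀ x ∈ D, 0 ≤ (aeval x Q : ℝ) ∧ (aeval x Q : ℝ) < 1
  /-- `0 < ω < 1` on `D` -/
  Ω_bound : ∀ x ∈ D, 0 < (aeval x Ω : ℝ) ∧ (aeval x Ω : ℝ) < 1
  /-- `C > 0` on `D` -/
  C_pos : ∀ x ∈ D, 0 < (aeval x C : ℝ)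
  /-- the `R₁`-integrand is integrable on `D ∩ {ω < xᵢ}` -/
  integrableOn_F1 : IntegrableOn (soloInformedStepF1 i Q Ω C) (D ∩ {x | (aeval x Ω : ℝ) < x i})
  /-- the `R₂`-integrand is integrable on `D` -/
  integrableOn_FS : IntegrableOn (soloInformedStepFS i Q Ω C) D

namespace SoloInformedTelDatum

variable {n : ℕ} (T : SoloInformedTelDatum n)

/-- `Q(x)`. -/
def q (x : Fin n → ℝ) : ℝ := aeval x T.Q
/-- `ω(x)`. -/
def ω (x : Fin n → ℝ) : ℝ := aeval x T.Ω
/-- `C(x)`. -/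
def cc (x : Fin n → ℝ) : ℝ := aeval x T.C

/-- `f₁`. -/
def f1 : (Fin n → ℝ) → ℝ := soloInformedStepF1 T.i T.Q T.Ω T.C
/-- `S`. -/
def fS : (Fin n → ℝ) → ℝ := soloInformedStepFS T.i T.Q T.Ω T.C
/-- `g = ω/(C (1 − Q xᵢ ω)(1 − ω)) = f₁ − S`. -/
def g (x : Fin n → ℝ) : ℝ := T.ω x / (T.cc x * (1 - T.q x * x T.i * T.ω x) * (1 - T.ω x))
/-- `f_V = ω/(C (1 − Q xᵢ ω)(1 − Q xᵢ ω²))`. -/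
def fV (x : Fin n → ℝ) : ℝ :=
  T.ω x / (T.cc x * (1 - T.q x * x T.i * T.ω x) * (1 - T.q x * x T.i * T.ω x ^ 2))
/-- The Möbius substitution `σ(x) = ω(ω + xᵢ(1 − ω − Qω²))/(1 − Qω²xᵢ)`. -/
def sig (x : Fin n → ℝ) : ℝ :=
  T.ω x * (T.ω x + x T.i * (1 - T.ω x - T.q x * T.ω x ^ 2)) / (1 - T.q x * T.ω x ^ 2 * x T.i)

/-- Auxiliary (telescope step): `f1_eq`. -/
theorem f1_eq (x : Fin n → ℝ) :
    T.f1 x = 1 / (T.cc x * (1 - T.q x * x T.i) * (1 - T.ω x)) := rfl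
/-- Auxiliary (telescope step): `fS_eq`. -/
theorem fS_eq (x : Fin n → ℝ) :
    T.fS x = 1 / (T.cc x * (1 - T.q x * x T.i) * (1 - T.q x * x T.i * T.ω x)) := rfl

/-! ### sign facts on `D` -/
section signs
variable {T} {x : Fin n → ℝ} (hx : x ∈ T.D)
include hx

/-- Auxiliary (telescope step): `q_nonneg`. -/
theorem q_nonneg : 0 ≤ T.q x := (T.Q_bound x hx).1
/-- Auxiliary (telescope step): `q_lt_one`. -/
theorem q_lt_one : T.q x < 1 := (T.Q_bound x hx).2
/-- Auxiliary (telescope step): `ω_pos`. -/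
theorem ω_pos : 0 < T.ω x := (T.Ω_bound x hx).1
/-- Auxiliary (telescope step): `ω_lt_one`. -/
theorem ω_lt_one : T.ω x < 1 := (T.Ω_bound x hx).2
/-- Auxiliary (telescope step): `cc_pos`. -/
theorem cc_pos : 0 < T.cc x := T.C_pos x hx
/-- Auxiliary (telescope step): `xi_pos`. -/
theorem xi_pos : 0 < x T.i := (T.mem_Ioo x hx).1
/-- Auxiliary (telescope step): `xi_lt_one`. -/
theorem xi_lt_one : x T.i < 1 := (T.mem_Ioo x hx).2

/-- Auxiliary (telescope step): `one_sub_qxi_pos`. -/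
theorem one_sub_qxi_pos : 0 < 1 - T.q x * x T.i := by
  have := mul_le_of_le_one_right (q_nonneg hx) (xi_lt_one hx).le
  nlinarith [q_lt_one hx, q_nonneg hx, xi_pos hx]

/-- Auxiliary (telescope step): `one_sub_qxiω_pos`. -/
theorem one_sub_qxiω_pos : 0 < 1 - T.q x * x T.i * T.ω x := by
  have h1 : T.q x * x T.i * T.ω x ≤ T.q x * x T.i :=
    mul_le_of_le_one_right (mul_nonneg (q_nonneg hx) (xi_pos hx).le) (ω_lt_one hx).le
  linarith [one_sub_qxi_pos hx]

/-- Auxiliary (telescope step): `one_sub_qxiωω_pos`. -/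
theorem one_sub_qxiωω_pos : 0 < 1 - T.q x * x T.i * T.ω x ^ 2 := by
  have h1 : T.q x * x T.i * T.ω x ^ 2 ≤ T.q x * x T.i * T.ω x := by
    have := mul_nonneg (mul_nonneg (q_nonneg hx) (xi_pos hx).le) (ω_pos hx).le
    nlinarith [ω_lt_one hx]
  linarith [one_sub_qxiω_pos hx]

/-- Auxiliary (telescope step): `one_sub_qωω_pos`. -/
theorem one_sub_qωω_pos : 0 < 1 - T.q x * T.ω x ^ 2 := by
  have hω2 : T.ω x ^ 2 ≤ 1 := by nlinarith [ω_lt_one hx, ω_pos hx]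
  have h1 : T.q x * T.ω x ^ 2 ≤ T.q x := mul_le_of_le_one_right (q_nonneg hx) hω2
  linarith [q_lt_one hx]

/-- Auxiliary (telescope step): `one_sub_qωωxi_pos`. -/
theorem one_sub_qωωxi_pos : 0 < 1 - T.q x * T.ω x ^ 2 * x T.i := by
  have h1 : T.q x * T.ω x ^ 2 * x T.i ≤ T.q x * T.ω x ^ 2 :=
    mul_le_of_le_one_right (mul_nonneg (q_nonneg hx) (sq_nonneg _)) (xi_lt_one hx).le
  linarith [one_sub_qωω_pos hx]

/-- Auxiliary (telescope step): `f1_pos`. -/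
theorem f1_pos : 0 < T.f1 x := by
  rw [f1_eq]
  exact one_div_pos.2 (mul_pos (mul_pos (cc_pos hx) (one_sub_qxi_pos hx))
    (by linarith [ω_lt_one hx]))

/-- Auxiliary (telescope step): `fS_pos`. -/
theorem fS_pos : 0 < T.fS x :=
  one_div_pos.2 (mul_pos (mul_pos (cc_pos hx) (one_sub_qxi_pos hx)) (one_sub_qxiω_pos hx))

/-- **(1b) pointwise:** `f₁ = S + g`. -/
theorem f1_eq_fS_add_g : T.f1 x = T.fS x + T.g x := by
  rw [f1_eq, fS_eq, g]
  have h1 := (cc_pos hx).ne'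
  have h2 := (one_sub_qxi_pos hx).ne'
  have h3 := (one_sub_qxiω_pos hx).ne'
  have h4 : (1 - T.ω x) ≠ 0 := by linarith [ω_lt_one hx]
  field_simp
  ring

end signs

/-! ### invariance under the active coordinate -/

/-- Auxiliary (telescope step): `q_update`. -/
theorem q_update (x : Fin n → ℝ) (t : ℝ) : T.q (Function.update x T.i t) = T.q x :=
  soloInformed_aeval_update T.vars_Q x t
/-- Auxiliary (telescope step): `ω_update`. -/
theorem ω_update (x : Fin n → ℝ) (t : ℝ) : T.ω (Function.update x T.i t) = T.ω x :=
  soloInformed_aeval_update T.vars_Ω x t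
/-- Auxiliary (telescope step): `cc_update`. -/
theorem cc_update (x : Fin n → ℝ) (t : ℝ) : T.cc (Function.update x T.i t) = T.cc x :=
  soloInformed_aeval_update T.vars_C x t

/-! ## 2. The domains -/

/-- `D₁ = D ∩ {ω < xᵢ}`. -/
def D1 : Set (Fin n → ℝ) := T.D ∩ {x | T.ω x < x T.i}
/-- `D₂ = D ∩ {xᵢ < ω}`. -/
def D2 : Set (Fin n → ℝ) := T.D ∩ {x | x T.i < T.ω x}
/-- `D♯ = D ∩ {ω² < xᵢ < ω}`. -/
def Ds : Set (Fin n → ℝ) := T.D ∩ {x | T.ω x ^ 2 < x T.i ∧ x T.i < T.ω x}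

/-- Auxiliary (telescope step): `D1_subset`. -/
theorem D1_subset : T.D1 ⊆ T.D := inter_subset_left
/-- Auxiliary (telescope step): `D2_subset`. -/
theorem D2_subset : T.D2 ⊆ T.D := inter_subset_left
/-- Auxiliary (telescope step): `Ds_subset`. -/
theorem Ds_subset : T.Ds ⊆ T.D := inter_subset_left

/-- Auxiliary (telescope step): `continuous_ω`. -/
theorem continuous_ω : Continuous T.ω :=
  continuous_iff_continuousAt.2 fun x => (soloInformed_hasFDerivAt_aeval T.Ω x).continuousAt
/-- Auxiliary (telescope step): `continuous_q`. -/
theorem continuous_q : Continuous T.q :=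
  continuous_iff_continuousAt.2 fun x => (soloInformed_hasFDerivAt_aeval T.Q x).continuousAt
/-- Auxiliary (telescope step): `continuous_cc`. -/
theorem continuous_cc : Continuous T.cc :=
  continuous_iff_continuousAt.2 fun x => (soloInformed_hasFDerivAt_aeval T.C x).continuousAt

/-- Auxiliary (telescope step): `isSemialgebraic_D1`. -/
theorem isSemialgebraic_D1 : IsSemialgebraic ℚ T.D1 := by
  refine T.isSemialgebraic_D.inter ?_
  simpa [ω] using isSemialgebraic_setOf_eval_lt (k := ℚ) (R := ℝ) T.Ω (X T.i)

/-- Auxiliary (telescope step): `isSemialgebraic_D2`. -/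
theorem isSemialgebraic_D2 : IsSemialgebraic ℚ T.D2 := by
  refine T.isSemialgebraic_D.inter ?_
  simpa [ω] using isSemialgebraic_setOf_eval_lt (k := ℚ) (R := ℝ) (X T.i) T.Ω

/-- Auxiliary (telescope step): `isSemialgebraic_Ds`. -/
theorem isSemialgebraic_Ds : IsSemialgebraic ℚ T.Ds := by
  have h1 : IsSemialgebraic ℚ {x : Fin n → ℝ | T.ω x ^ 2 < x T.i} := by
    have hS : {x : Fin n → ℝ | T.ω x ^ 2 < x T.i} =
        {x : Fin n → ℝ | (aeval x (T.Ω ^ 2) : ℝ) < (aeval x (X T.i : MvPolynomial (Fin n) ℚ) : ℝ)} := by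
      ext x; simp only [mem_setOf_eq, map_pow, aeval_X]; rfl
    rw [hS]
    exact isSemialgebraic_setOf_eval_lt (k := ℚ) (R := ℝ) (T.Ω ^ 2) (X T.i)
  have h2 : IsSemialgebraic ℚ {x : Fin n → ℝ | x T.i < T.ω x} := by
    simpa [ω] using isSemialgebraic_setOf_eval_lt (k := ℚ) (R := ℝ) (X T.i) T.Ω
  simpa [Ds, setOf_and] using T.isSemialgebraic_D.inter (h1.inter h2)

/-- Auxiliary (telescope step): `measurableSet_D1`. -/
theorem measurableSet_D1 : MeasurableSet T.D1 :=
  T.measurableSet_D.inter (measurableSet_lt T.continuous_ω.measurable (measurable_pi_apply T.i))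

/-- Auxiliary (telescope step): `measurableSet_D2`. -/
theorem measurableSet_D2 : MeasurableSet T.D2 :=
  T.measurableSet_D.inter (measurableSet_lt (measurable_pi_apply T.i) T.continuous_ω.measurable)

/-- Auxiliary (telescope step): `measurableSet_Ds`. -/
theorem measurableSet_Ds : MeasurableSet T.Ds :=
  T.measurableSet_D.inter ((measurableSet_lt (T.continuous_ω.pow 2).measurable
    (measurable_pi_apply T.i)).inter
    (measurableSet_lt (measurable_pi_apply T.i) T.continuous_ω.measurable))

end SoloInformedTelDatum

end Summit.KontsevichZagierPeriods.KontsevichZagierPeriods.Theorems
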